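import Summits.RiemannHypothesis.RiemannHypothesis.Theorems.WeilFormatCPolyWindowMixedRegroup
import Summits.RiemannHypothesis.RiemannHypothesis.Theorems.WeilFormatCTailJPrelim
import HarnessLib

/-!
# Format C, design C∞: the mixed entries as REAL family sums — two mode functions `F_m = J_s + S_m`, `G_m = J_c − C_m`

Route context: Fourier–Galerkin / Schur-complement certificates of Weil positivity on a window ("format C";
cell memo `run/shared/lean/pub/rh-explicit/rh-explicit-weil-10/KERNEL-LEVER.md` §20; supporting stmt-RiemannHypothesis-0098;
seat rh-explicit-weil-10).

`weilWindowSesq_indicator_pow_chi_regroup` writes `W_a(1x^j, χ_m)` over COMPLEX families `J^±(m) − E^±(m)`.  Since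
`J^± = J_c ∓ iJ_s` and `E^± = C_m ± iS_m` (`C_m = Σ_n Λ(n)n^{-1/2}cos(ω_m log n)`, `S_m = Σ_n Λ(n)n^{-1/2}sin(ω_m log n)`), both
differences involve only the two REAL combinations

  `G_m := J_c(m) − C_m`   and   `F_m := J_s(m) + S_m`

(`J^+ − E^+ = G_m − iF_m`, `J^− − E^− = G_m + iF_m`), and `F_m` is exactly the MODE FUNCTION `½Y_m + S_m − T_m` of the block rows
(`WeilFormatCColumnKernel`, `WeilFormatCTailEvenJ`; `J_s = ½Y_m − T_m` by `setIntegral_weilArchDensity_mul_sin`).  Hence the real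
and imaginary parts of every image are sums over `k ≤ j` of `(a/(πm))^{k+1}` times `{1, F_m, G_m}` with explicit real coefficients,
plus the polar pair — the rows and the images of the C∞ door share ONE oscillatory family `F_m·m^{−e}` and the images add ONE more,
`G_m·m^{−e}` (`G_m = ½log m + κ(a) + ε_m − C_m`, `WeilFormatCMixedArchAsymptotics`):

* `re_weilWindowSesq_indicator_pow_chi` —
  `Re W = (2a)^{-1/2}(−1)^m [ 4C_j(e^{a/2}−e^{−a/2})/(1+4ω²) + Σ_k (−1)^k j^{(k)} (a/(πm))^{k+1}`
  `      ( Re(i^{k+1}K_{j,k}) + (a^{j−k} − (−a)^{j−k}) Re(i^{k+1}) G_m + (a^{j−k} + (−a)^{j−k}) Im(i^{k+1}) F_m ) ]`;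
* `im_weilWindowSesq_indicator_pow_chi` —
  `Im W = (2a)^{-1/2}(−1)^m [ −8S_j(e^{a/2}−e^{−a/2})ω/(1+4ω²) + Σ_k (−1)^k j^{(k)} (a/(πm))^{k+1}`
  `      ( Im(i^{k+1}K_{j,k}) + (a^{j−k} − (−a)^{j−k}) Im(i^{k+1}) G_m − (a^{j−k} + (−a)^{j−k}) Re(i^{k+1}) F_m ) ]`.

Plus the polar pair EXPANDED for integer modes (`abs_polarFactor_int_sub_sum_le`, `abs_oddPolarFactor_int_sub_sum_le`:
`WeilFormatCTailJPrelim`'s geometric expansions at `|m|`), so no polar family functions remain on the (E) side.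

Pure algebra on the regrouped closed form; standard axioms; no RH claim.
-/

set_option autoImplicit false
-- `Summit.RiemannHypothesis.RiemannHypothesis.…` is the layout-mandated namespace (summit = problem name).
set_option linter.dupNamespace false

noncomputable section

open Complex Filter Set MeasureTheory
open scoped Real Topology ComplexConjugate ArithmeticFunction.vonMangoldt

namespace Summit.RiemannHypothesis.RiemannHypothesis.Theorems.WeilFormatC

open Literature.NumberTheory.LFunctions Literature.NumberTheory.LFunctions.Yoshida1992
  Literature.Analysis.SpecialFunctions

variable {a : ℝ}

/-- Real and imaginary parts of one regrouped term: for real `r, A, B, G, F` and complex `K`,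
`r·i^{k+1}·(K + A(G − iF) − B(G + iF))` has real part `r(Re(i^{k+1}K) + (A−B)Re(i^{k+1})G + (A+B)Im(i^{k+1})F)` and
imaginary part `r(Im(i^{k+1}K) + (A−B)Im(i^{k+1})G − (A+B)Re(i^{k+1})F)`. -/
theorem re_im_regroup_term (r A B G F : ℝ) (K : ℂ) (k : ℕ) :
    ((r : ℂ) * I ^ (k + 1) * (K + (A : ℂ) * ((G : ℂ) - I * F) - (B : ℂ) * ((G : ℂ) + I * F))).re
        = r * ((I ^ (k + 1) * K).re + (A - B) * (I ^ (k + 1)).re * G + (A + B) * (I ^ (k + 1)).im * F)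
      ∧ ((r : ℂ) * I ^ (k + 1) * (K + (A : ℂ) * ((G : ℂ) - I * F) - (B : ℂ) * ((G : ℂ) + I * F))).im
        = r * ((I ^ (k + 1) * K).im + (A - B) * (I ^ (k + 1)).im * G - (A + B) * (I ^ (k + 1)).re * F) := by
  constructor
  · simp only [Complex.mul_re, Complex.add_re, Complex.sub_re, Complex.mul_im, Complex.add_im, Complex.sub_im,
      Complex.ofReal_re, Complex.ofReal_im, Complex.I_re, Complex.I_im]
    ring
  · simp only [Complex.mul_re, Complex.add_re, Complex.sub_re, Complex.mul_im, Complex.add_im, Complex.sub_im,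
      Complex.ofReal_re, Complex.ofReal_im, Complex.I_re, Complex.I_im]
    ring

/-- **The mixed entry over the REAL families** (`a > 0`, `m ≠ 0`): the complex regrouped form with `J^± = J_c ∓ iJ_s`,
`E^± = C_m ± iS_m` and `X_m^{−(k+1)} = (ia/(πm))^{k+1}` substituted, i.e. every `k`-term is
`(−1)^k j^{(k)} (a/(πm))^{k+1} · i^{k+1} · (K_{j,k} + a^{j−k}(G_m − iF_m) − (−a)^{j−k}(G_m + iF_m))`,
`G_m = J_c(m) − C_m`, `F_m = J_s(m) + S_m`. -/
theorem weilWindowSesq_indicator_pow_chi_real_families (ha : 0 < a) {m : ℤ} (hm : m ≠ 0) (j : ℕ) :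
    weilWindowSesq a ((Icc (-a) a).indicator fun x : ℝ ↦ ((x : ℂ)) ^ j) (chi a m) =
      ((1 / Real.sqrt (2 * a) : ℝ) : ℂ) * (-1 : ℂ) ^ m *
        ( ((4 * (∫ x in (-a)..a, x ^ j * Real.cosh (x / 2)) * (Real.exp (a / 2) - Real.exp (-(a / 2))) : ℝ) : ℂ)
              * (((1 / (1 + 4 * (π * m / a) ^ 2) : ℝ)) : ℂ)
          - ((8 * (∫ x in (-a)..a, x ^ j * Real.sinh (x / 2)) * (Real.exp (a / 2) - Real.exp (-(a / 2))) : ℝ) : ℂ)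
              * ((((π * m / a) / (1 + 4 * (π * m / a) ^ 2) : ℝ)) : ℂ) * I
          + ∑ k ∈ Finset.range (j + 1),
              (((-1 : ℝ) ^ k * (j.descFactorial k : ℝ) * (a / (π * m)) ^ (k + 1) : ℝ) : ℂ) * I ^ (k + 1) *
              ( ((∑ n ∈ weilPrimeIndex a, ((Λ n : ℝ) / Real.sqrt n : ℂ) *
                    (((a : ℂ)) ^ (j - k) - (((-a : ℝ)) : ℂ) ^ (j - k)
                      + (((a : ℂ)) ^ (j - k) - (((a - Real.log n : ℝ)) : ℂ) ^ (j - k))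
                      + ((((-a + Real.log n : ℝ)) : ℂ) ^ (j - k) - (((-a : ℝ)) : ℂ) ^ (j - k))))
                  + ((∫ t in Ioc 0 (2 * a), weilArchDensity t *
                      ((a ^ (j - k) - (a - t) ^ (j - k)) + ((-a + t) ^ (j - k) - (-a) ^ (j - k))) : ℝ) : ℂ)
                  + (2 * ((∫ t in Ioi (2 * a), weilArchDensity t : ℝ) : ℂ) - (weilMarkovConstant a : ℂ))
                      * (((a : ℂ)) ^ (j - k) - (((-a : ℝ)) : ℂ) ^ (j - k)))
                + ((a ^ (j - k) : ℝ) : ℂ) *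
                    (((((∫ t in Ioc 0 (2 * a), weilArchDensity t * (1 - Real.cos (π * m / a * t)))
                        - ∑ n ∈ weilPrimeIndex a, (Λ n : ℝ) / Real.sqrt n * Real.cos (π * m / a * Real.log n) : ℝ) : ℂ)
                      - I * (((∫ t in Ioc 0 (2 * a), weilArchDensity t * Real.sin (π * m / a * t))
                        + ∑ n ∈ weilPrimeIndex a, (Λ n : ℝ) / Real.sqrt n * Real.sin (π * m / a * Real.log n) : ℝ) : ℂ)))
                - (((-a) ^ (j - k) : ℝ) : ℂ) *
                    (((((∫ t in Ioc 0 (2 * a), weilArchDensity t * (1 - Real.cos (π * m / a * t)))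
                        - ∑ n ∈ weilPrimeIndex a, (Λ n : ℝ) / Real.sqrt n * Real.cos (π * m / a * Real.log n) : ℝ) : ℂ)
                      + I * (((∫ t in Ioc 0 (2 * a), weilArchDensity t * Real.sin (π * m / a * t))
                        + ∑ n ∈ weilPrimeIndex a, (Λ n : ℝ) / Real.sqrt n * Real.sin (π * m / a * Real.log n) : ℝ) : ℂ))) ) ) := by
  rw [weilWindowSesq_indicator_pow_chi_regroup ha hm j, setIntegral_weilArchDensity_mul_one_sub_cexp ha (π * m / a),
    setIntegral_weilArchDensity_mul_one_sub_cexp_neg ha (π * m / a), (sum_vonMangoldt_cexp_freq_eq a (π * m / a)).1,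
    (sum_vonMangoldt_cexp_freq_eq a (π * m / a)).2]
  congr 1
  congr 1
  refine Finset.sum_congr rfl fun k _ ↦ ?_
  have hX : (-1 : ℂ) ^ k * (j.descFactorial k : ℂ) / (-(I * (π * m / a : ℝ))) ^ (k + 1)
      = (((-1 : ℝ) ^ k * (j.descFactorial k : ℝ) * (a / (π * m)) ^ (k + 1) : ℝ) : ℂ) * I ^ (k + 1) := by
    rw [div_eq_mul_one_div, inv_negI_freq_pow ha.ne' hm k, mul_pow]
    push_cast
    ring
  rw [hX]
  congr 1
  push_cast
  ring

/-- **Real part of the mixed entry over the real families** (`a > 0`, `m ≠ 0`): with `G_m = J_c(m) − C_m`, `F_m = J_s(m) + S_m`,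
`Re W_a(1x^j, χ_m) = (2a)^{-1/2}(−1)^m [ 4C_j(e^{a/2}−e^{−a/2})·1/(1+4ω²)`
`  + Σ_k (−1)^k j^{(k)} (a/(πm))^{k+1} (Re(i^{k+1}K_{j,k}) + (a^{j−k} − (−a)^{j−k})Re(i^{k+1})·G_m + (a^{j−k} + (−a)^{j−k})Im(i^{k+1})·F_m) ]`. -/
theorem re_weilWindowSesq_indicator_pow_chi (ha : 0 < a) {m : ℤ} (hm : m ≠ 0) (j : ℕ) :
    (weilWindowSesq a ((Icc (-a) a).indicator fun x : ℝ ↦ ((x : ℂ)) ^ j) (chi a m)).re =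
      (1 / Real.sqrt (2 * a)) * (-1 : ℝ) ^ m *
        ( (4 * (∫ x in (-a)..a, x ^ j * Real.cosh (x / 2)) * (Real.exp (a / 2) - Real.exp (-(a / 2))))
              * (1 / (1 + 4 * (π * m / a) ^ 2))
          + ∑ k ∈ Finset.range (j + 1), ((-1 : ℝ) ^ k * (j.descFactorial k : ℝ) * (a / (π * m)) ^ (k + 1)) *
              ( (I ^ (k + 1) *
                  ((∑ n ∈ weilPrimeIndex a, ((Λ n : ℝ) / Real.sqrt n : ℂ) *
                      (((a : ℂ)) ^ (j - k) - (((-a : ℝ)) : ℂ) ^ (j - k)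
                        + (((a : ℂ)) ^ (j - k) - (((a - Real.log n : ℝ)) : ℂ) ^ (j - k))
                        + ((((-a + Real.log n : ℝ)) : ℂ) ^ (j - k) - (((-a : ℝ)) : ℂ) ^ (j - k))))
                    + ((∫ t in Ioc 0 (2 * a), weilArchDensity t *
                        ((a ^ (j - k) - (a - t) ^ (j - k)) + ((-a + t) ^ (j - k) - (-a) ^ (j - k))) : ℝ) : ℂ)
                    + (2 * ((∫ t in Ioi (2 * a), weilArchDensity t : ℝ) : ℂ) - (weilMarkovConstant a : ℂ))
                        * (((a : ℂ)) ^ (j - k) - (((-a : ℝ)) : ℂ) ^ (j - k)))).re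
                + (a ^ (j - k) - (-a) ^ (j - k)) * (I ^ (k + 1)).re *
                    ((∫ t in Ioc 0 (2 * a), weilArchDensity t * (1 - Real.cos (π * m / a * t)))
                      - ∑ n ∈ weilPrimeIndex a, (Λ n : ℝ) / Real.sqrt n * Real.cos (π * m / a * Real.log n))
                + (a ^ (j - k) + (-a) ^ (j - k)) * (I ^ (k + 1)).im *
                    ((∫ t in Ioc 0 (2 * a), weilArchDensity t * Real.sin (π * m / a * t))
                      + ∑ n ∈ weilPrimeIndex a, (Λ n : ℝ) / Real.sqrt n * Real.sin (π * m / a * Real.log n)) ) ) := by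
  rw [weilWindowSesq_indicator_pow_chi_real_families ha hm j]
  have hsgn : ((-1 : ℂ)) ^ m = (((-1 : ℝ) ^ m : ℝ) : ℂ) := by push_cast; rfl
  rw [hsgn, ← Complex.ofReal_mul, Complex.re_ofReal_mul]
  congr 1
  rw [Complex.add_re, Complex.sub_re, Complex.re_sum]
  have h1 : (((4 * (∫ x in (-a)..a, x ^ j * Real.cosh (x / 2)) * (Real.exp (a / 2) - Real.exp (-(a / 2))) : ℝ) : ℂ)
      * (((1 / (1 + 4 * (π * m / a) ^ 2) : ℝ)) : ℂ)).re
      = (4 * (∫ x in (-a)..a, x ^ j * Real.cosh (x / 2)) * (Real.exp (a / 2) - Real.exp (-(a / 2))))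
          * (1 / (1 + 4 * (π * m / a) ^ 2)) := by
    rw [← Complex.ofReal_mul, Complex.ofReal_re]
  have h2 : (((8 * (∫ x in (-a)..a, x ^ j * Real.sinh (x / 2)) * (Real.exp (a / 2) - Real.exp (-(a / 2))) : ℝ) : ℂ)
      * ((((π * m / a) / (1 + 4 * (π * m / a) ^ 2) : ℝ)) : ℂ) * I).re = 0 := by
    rw [← Complex.ofReal_mul, Complex.mul_re, Complex.ofReal_re, Complex.ofReal_im, Complex.I_re, Complex.I_im]
    ring
  rw [h1, h2, sub_zero]
  congr 1
  refine Finset.sum_congr rfl fun k _ ↦ ?_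
  exact (re_im_regroup_term _ _ _ _ _ _ k).1

/-- **Imaginary part of the mixed entry over the real families** (`a > 0`, `m ≠ 0`):
`Im W_a(1x^j, χ_m) = (2a)^{-1/2}(−1)^m [ −8S_j(e^{a/2}−e^{−a/2})·ω/(1+4ω²)`
`  + Σ_k (−1)^k j^{(k)} (a/(πm))^{k+1} (Im(i^{k+1}K_{j,k}) + (a^{j−k} − (−a)^{j−k})Im(i^{k+1})·G_m − (a^{j−k} + (−a)^{j−k})Re(i^{k+1})·F_m) ]`. -/
theorem im_weilWindowSesq_indicator_pow_chi (ha : 0 < a) {m : ℤ} (hm : m ≠ 0) (j : ℕ) :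
    (weilWindowSesq a ((Icc (-a) a).indicator fun x : ℝ ↦ ((x : ℂ)) ^ j) (chi a m)).im =
      (1 / Real.sqrt (2 * a)) * (-1 : ℝ) ^ m *
        ( -((8 * (∫ x in (-a)..a, x ^ j * Real.sinh (x / 2)) * (Real.exp (a / 2) - Real.exp (-(a / 2))))
              * ((π * m / a) / (1 + 4 * (π * m / a) ^ 2)))
          + ∑ k ∈ Finset.range (j + 1), ((-1 : ℝ) ^ k * (j.descFactorial k : ℝ) * (a / (π * m)) ^ (k + 1)) *
              ( (I ^ (k + 1) *
                  ((∑ n ∈ weilPrimeIndex a, ((Λ n : ℝ) / Real.sqrt n : ℂ) *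
                      (((a : ℂ)) ^ (j - k) - (((-a : ℝ)) : ℂ) ^ (j - k)
                        + (((a : ℂ)) ^ (j - k) - (((a - Real.log n : ℝ)) : ℂ) ^ (j - k))
                        + ((((-a + Real.log n : ℝ)) : ℂ) ^ (j - k) - (((-a : ℝ)) : ℂ) ^ (j - k))))
                    + ((∫ t in Ioc 0 (2 * a), weilArchDensity t *
                        ((a ^ (j - k) - (a - t) ^ (j - k)) + ((-a + t) ^ (j - k) - (-a) ^ (j - k))) : ℝ) : ℂ)
                    + (2 * ((∫ t in Ioi (2 * a), weilArchDensity t : ℝ) : ℂ) - (weilMarkovConstant a : ℂ))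
                        * (((a : ℂ)) ^ (j - k) - (((-a : ℝ)) : ℂ) ^ (j - k)))).im
                + (a ^ (j - k) - (-a) ^ (j - k)) * (I ^ (k + 1)).im *
                    ((∫ t in Ioc 0 (2 * a), weilArchDensity t * (1 - Real.cos (π * m / a * t)))
                      - ∑ n ∈ weilPrimeIndex a, (Λ n : ℝ) / Real.sqrt n * Real.cos (π * m / a * Real.log n))
                - (a ^ (j - k) + (-a) ^ (j - k)) * (I ^ (k + 1)).re *
                    ((∫ t in Ioc 0 (2 * a), weilArchDensity t * Real.sin (π * m / a * t))
                      + ∑ n ∈ weilPrimeIndex a, (Λ n : ℝ) / Real.sqrt n * Real.sin (π * m / a * Real.log n)) ) ) := by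
  rw [weilWindowSesq_indicator_pow_chi_real_families ha hm j]
  have hsgn : ((-1 : ℂ)) ^ m = (((-1 : ℝ) ^ m : ℝ) : ℂ) := by push_cast; rfl
  rw [hsgn, ← Complex.ofReal_mul, Complex.im_ofReal_mul]
  congr 1
  rw [Complex.add_im, Complex.sub_im, Complex.im_sum]
  have h1 : (((4 * (∫ x in (-a)..a, x ^ j * Real.cosh (x / 2)) * (Real.exp (a / 2) - Real.exp (-(a / 2))) : ℝ) : ℂ)
      * (((1 / (1 + 4 * (π * m / a) ^ 2) : ℝ)) : ℂ)).im = 0 := by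
    rw [← Complex.ofReal_mul, Complex.ofReal_im]
  have h2 : (((8 * (∫ x in (-a)..a, x ^ j * Real.sinh (x / 2)) * (Real.exp (a / 2) - Real.exp (-(a / 2))) : ℝ) : ℂ)
      * ((((π * m / a) / (1 + 4 * (π * m / a) ^ 2) : ℝ)) : ℂ) * I).im
      = (8 * (∫ x in (-a)..a, x ^ j * Real.sinh (x / 2)) * (Real.exp (a / 2) - Real.exp (-(a / 2))))
          * ((π * m / a) / (1 + 4 * (π * m / a) ^ 2)) := by
    rw [← Complex.ofReal_mul, Complex.mul_im, Complex.ofReal_re, Complex.ofReal_im, Complex.I_re, Complex.I_im]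
    ring
  rw [h1, h2, zero_sub]
  congr 1
  refine Finset.sum_congr rfl fun k _ ↦ ?_
  exact (re_im_regroup_term _ _ _ _ _ _ k).2

/-! ## The polar pair expanded, for integer modes -/

/-- An integer mode is `±` a natural number `≥ 1`. -/
theorem int_cast_eq_natAbs_or_neg {m : ℤ} (hm : m ≠ 0) :
    ∃ n : ℕ, 1 ≤ n ∧ ((m : ℝ) = n ∨ (m : ℝ) = -(n : ℝ)) := by
  refine ⟨m.natAbs, Int.natAbs_pos.2 hm, ?_⟩
  rcases Int.natAbs_eq m with h | h
  · left
    have h' := congrArg (fun z : ℤ ↦ (z : ℝ)) h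
    simpa only [Int.cast_natCast] using h'
  · right
    have h' := congrArg (fun z : ℤ ↦ (z : ℝ)) h
    simpa only [Int.cast_neg, Int.cast_natCast] using h'

/-- **Even polar factor expanded, integer modes** (`a > 0`, `m ≠ 0`, `q = a²/(4π²)`):
`|1/(1+4ω_m²) − Σ_{r<J} (−1)^r q^{r+1}/m^{2r+2}| ≤ q^{J+1}/|m|^{2J+2}` (`abs_polarFactor_sub_sum_le` at `|m|`). -/
theorem abs_polarFactor_int_sub_sum_le (ha : 0 < a) {m : ℤ} (hm : m ≠ 0) (J : ℕ) :
    |1 / (1 + 4 * (π * m / a) ^ 2)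
        - ∑ r ∈ Finset.range J, (-1 : ℝ) ^ r * (a ^ 2 / (4 * π ^ 2)) ^ (r + 1) / (m : ℝ) ^ (2 * r + 2)|
      ≤ (a ^ 2 / (4 * π ^ 2)) ^ (J + 1) / |(m : ℝ)| ^ (2 * J + 2) := by
  obtain ⟨n, hn1, hmn⟩ := int_cast_eq_natAbs_or_neg hm
  have h := abs_polarFactor_sub_sum_le ha hn1 J
  rw [freq_natCast] at h
  have hsq : ((m : ℝ)) ^ 2 = (n : ℝ) ^ 2 := by
    rcases hmn with e | e
    · rw [e]
    · rw [e, neg_sq]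
  have habs : |(m : ℝ)| = n := by
    rcases hmn with e | e
    · rw [e, abs_of_nonneg (Nat.cast_nonneg n)]
    · rw [e, abs_neg, abs_of_nonneg (Nat.cast_nonneg n)]
  have hpow : ∀ r : ℕ, ((m : ℝ)) ^ (2 * r + 2) = (n : ℝ) ^ (2 * r + 2) := fun r ↦ by
    rw [show 2 * r + 2 = 2 * (r + 1) by ring, pow_mul, pow_mul, hsq]
  have hω : (π * m / a) ^ 2 = (π * n / a) ^ 2 := by
    rw [div_pow, div_pow, mul_pow, mul_pow, hsq]
  rw [hω, habs, Finset.sum_congr rfl fun r _ ↦ by rw [hpow r]]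
  exact h

/-- **Odd polar factor expanded, integer modes** (`a > 0`, `m ≠ 0`):
`|ω_m/(1+4ω_m²) − Σ_{r<J} (−1)^r (a/(4π)) q^r/m^{2r+1}| ≤ (a/(4π)) q^J/|m|^{2J+1}` (`abs_oddPolarFactor_sub_sum_le` at `|m|`,
odd in `m`). -/
theorem abs_oddPolarFactor_int_sub_sum_le (ha : 0 < a) {m : ℤ} (hm : m ≠ 0) (J : ℕ) :
    |(π * m / a) / (1 + 4 * (π * m / a) ^ 2)
        - ∑ r ∈ Finset.range J, (-1 : ℝ) ^ r * (a / (4 * π)) * (a ^ 2 / (4 * π ^ 2)) ^ r / (m : ℝ) ^ (2 * r + 1)|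
      ≤ a / (4 * π) * (a ^ 2 / (4 * π ^ 2)) ^ J / |(m : ℝ)| ^ (2 * J + 1) := by
  obtain ⟨n, hn1, hmn⟩ := int_cast_eq_natAbs_or_neg hm
  have h := abs_oddPolarFactor_sub_sum_le ha hn1 J
  rw [freq_natCast] at h
  rcases hmn with e | e
  · rw [e, Nat.abs_cast n]
    exact h
  · -- `m = −n`: every term is odd in `m`
    have hterm : ∀ r : ℕ, (-1 : ℝ) ^ r * (a / (4 * π)) * (a ^ 2 / (4 * π ^ 2)) ^ r / (-(n : ℝ)) ^ (2 * r + 1)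
        = -((-1 : ℝ) ^ r * (a / (4 * π)) * (a ^ 2 / (4 * π ^ 2)) ^ r / (n : ℝ) ^ (2 * r + 1)) := fun r ↦ by
      rw [Odd.neg_pow ⟨r, rfl⟩, div_neg]
    have hlhs : (π * -(n : ℝ) / a) / (1 + 4 * (π * -(n : ℝ) / a) ^ 2) = -((π * n / a) / (1 + 4 * (π * n / a) ^ 2)) := by
      rw [show π * -(n : ℝ) / a = -(π * n / a) by ring, neg_sq, neg_div]
    rw [e, abs_neg, Nat.abs_cast n, hlhs, Finset.sum_congr rfl fun r _ ↦ hterm r, Finset.sum_neg_distrib,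
      show -(π * (n : ℝ) / a / (1 + 4 * (π * n / a) ^ 2))
          - -∑ r ∈ Finset.range J, (-1 : ℝ) ^ r * (a / (4 * π)) * (a ^ 2 / (4 * π ^ 2)) ^ r / (n : ℝ) ^ (2 * r + 1)
        = -(π * (n : ℝ) / a / (1 + 4 * (π * n / a) ^ 2)
          - ∑ r ∈ Finset.range J, (-1 : ℝ) ^ r * (a / (4 * π)) * (a ^ 2 / (4 * π ^ 2)) ^ r / (n : ℝ) ^ (2 * r + 1)) by ring,
      abs_neg]
    exact h

-- Build note (lead ruling R14-3 append remedy, 2026-08-24): re-landed with byte-identical declarations to trigger the hub olean build.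
end Summit.RiemannHypothesis.RiemannHypothesis.Theorems.WeilFormatC
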